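import Mathlib

/-!
# `Balaban1983to89.B14RSplit` — CMP 119 §3 pp. 270–271: the index `k₁` and the split `𝐑_k = 𝐑′_k + 𝐑″_k` of the
# long-range terms (`𝐑′_k = Σ_{j=1}^{k₁} 𝐑^{(j)}` absorbed into `𝐄_k`, `𝐑″_k = Σ_{j=k₁+1}^{k} 𝐑^{(j)}` treated
# separately), with the nesting of the `L`-adic cube partitions behind it

statement-level skeleton of published theorems with citation tags; proofs where landed; nothing here is a claim
about the Yang–Mills mass gap.

CITATION HEADER (lean-in-tree rule).  Source: T. Bałaban, *Convergent renormalization expansions for lattice gauge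
theories*, Commun. Math. Phys. **119**, 243–285 (1988), doi:10.1007/bf01217741 [Balaban1988Convergent] (cell paper
B14; held `paper:balaban1988-cmp119-convergent-renormalization`, journal page = PDF page + 242; the passage below was
read on the x2 renders of PDF pp. 28–29 = pp. 270–271).  Mega-formalization `lit-balaban`, unit `lit-balaban-r11`
(CMP 119), SKELETON row `B14.Def§3.Rsplit` (PHASE2-TARGETS §C).

THE PRINTED TEXT (pp. 270–271, verbatim): *"At first we decompose the logarithm of the fluctuation field integral
into a sum of three expressions, which contribute mainly to the three terms. This decomposition is rather naturally
connected with the form of the fluctuation field effective action in (3.15), but we divide the expression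
determined by 𝐑_k into two parts, and we treat them differently. Let us recall that the Euclidean covariance
property (2.32) holds for Euclidean transformations leaving invariant the partition of the lattice T_η into
L^{−(k−j)}MR_j-cubes. For k − j large enough, more precisely for j ≤ k₁, where k₁ is the largest integer satisfying
L^{−(k−k₁)}MR_j ≤ L, the cubes of the partition are contained in L-cubes corresponding to the L-blocks. Therefore
the expression determined by the sum 𝐑′_k = Σ_{j=1}^{k₁} 𝐑^{(j)} is Euclidean covariant with respect to the
Euclidean transformations leaving invariant the lattice T^{(k+1)}. It has the same covariance property as the
expression determined by 𝐄_k, and we include it into 𝐄_k. The sum of the two expressions, 𝐑′_k and 𝐄_k, is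
denoted also by 𝐄_k. The sum of the remaining terms 𝐑″_k = Σ_{j=k₁+1}^{k} 𝐑^{(j)} is treated separately."*

READING NOTE (transcript defect T11 of ROWS-B14.md): the printed condition "L^{−(k−k₁)}MR_j ≤ L" carries a free
`j`; the sentence "for j ≤ k₁, where k₁ is the largest integer satisfying …" fixes the reading
`k₁ := max {j ≤ k : L^{−(k−j)}MR_j ≤ L}` (`covCond … k j` below, evaluated at `j = k₁`).  Since `R_j` is
non-decreasing in `j` ((2.5): `R_j` the least power of `L` with `R_j ≥ (log g_j⁻²)^r`, `g_j` decreasing) and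
`L^{−(k−j)}` is increasing in `j` (`L ≥ 1`), the condition is downward closed in `j` (`covCond_anti`), so it then
holds for EVERY `j ≤ k₁` (`covCond_of_le_kOne`) — which is what the covariance argument uses — and the two possible
readings of the misprint coincide.

WHAT IS TYPED (definitions with bodies + kernel-checked bookkeeping; the covariance property (2.32) itself and the
terms `𝐑^{(j)}`, `𝐄_k` are abstract — any additive commutative monoid `α`, any family `Rj : ℕ → α`):
* `covCond L M R k j` := `L^{−(k−j)}·M·R_j ≤ L` (as printed, `zpow`), `covCond_iff_mul` (⇔ `M·R_j ≤ L·L^{k−j}`);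
* `kOne L M R k` := the largest `j ≤ k` with `covCond` (`Nat.findGreatest`; `0` if none — then `𝐑′_k` is empty),
  `kOne_le`, `le_kOne`, `covCond_kOne`, `not_covCond_of_kOne_lt`, `covCond_anti`, `covCond_of_le_kOne`;
* `RPrime Rj k₁ = Σ_{j=1}^{k₁} Rj j`, `RDoublePrime Rj k₁ k = Σ_{j=k₁+1}^{k} Rj j`, `RPrime_add_RDoublePrime`
  (`= Σ_{j=1}^{k} Rj j` for `k₁ ≤ k`), `absorb_RPrime` (`𝐄_k + Σ_{j=1}^k 𝐑^{(j)} = (𝐄_k + 𝐑′_k) + 𝐑″_k`);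
* the geometric reason "the cubes of the partition are contained in L-cubes": nested `L`-adic partitions of `ℤ`,
  `ladic_nested` (`⌊⌊x/L^a⌋/L^{b−a}⌋ = ⌊x/L^b⌋`, `a ≤ b`), coordinatewise for cubes.
-/

open scoped BigOperators
open Finset

namespace Literature.MathematicalPhysics.QuantumFieldTheory.Balaban1983to89.B14.RSplit

/-! ## The condition and the index `k₁` -/

/-- **p. 270**: the condition `L^{−(k−j)} M R_j ≤ L` on the index `j ≤ k` (the `L^{−(k−j)}MR_j`-cubes of the
`j`-th partition, seen from the lattice `T_η` of the `k`-th step, have side at most `L`).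
[cite: Balaban1988Convergent, p.270] -/
def covCond (L M : ℝ) (R : ℕ → ℝ) (k j : ℕ) : Prop :=
  L ^ (-((k - j : ℕ) : ℤ)) * M * R j ≤ L

/-- `covCond` without negative powers: for `L > 0`, `L^{−(k−j)}MR_j ≤ L ⇔ M R_j ≤ L·L^{k−j}`.
[cite: Balaban1988Convergent, p.270] -/
theorem covCond_iff_mul {L : ℝ} (hL : 0 < L) (M : ℝ) (R : ℕ → ℝ) (k j : ℕ) :
    covCond L M R k j ↔ M * R j ≤ L * L ^ (k - j) := by
  unfold covCond
  have hp : 0 < L ^ (k - j) := pow_pos hL _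
  rw [zpow_neg, zpow_natCast, mul_assoc, inv_mul_le_iff₀ hp, mul_comm (L ^ (k - j)) L]

open Classical in
/-- **p. 270: `k₁`** := the largest integer `j ≤ k` satisfying `L^{−(k−j)} M R_j ≤ L` (`0` if there is none, in
which case `𝐑′_k` below is the empty sum).  Reading of the printed "L^{−(k−k₁)}MR_j ≤ L" fixed as in the module
docstring. [cite: Balaban1988Convergent, p.270] -/
noncomputable def kOne (L M : ℝ) (R : ℕ → ℝ) (k : ℕ) : ℕ :=
  Nat.findGreatest (covCond L M R k) k

/-- `k₁ ≤ k`. [cite: Balaban1988Convergent, p.270] -/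
theorem kOne_le (L M : ℝ) (R : ℕ → ℝ) (k : ℕ) : kOne L M R k ≤ k := by
  classical
  exact Nat.findGreatest_le k

/-- Every `j ≤ k` satisfying the condition is `≤ k₁` ("the largest integer satisfying …").
[cite: Balaban1988Convergent, p.270] -/
theorem le_kOne {L M : ℝ} {R : ℕ → ℝ} {k j : ℕ} (hj : j ≤ k) (h : covCond L M R k j) : j ≤ kOne L M R k := by
  classical
  exact Nat.le_findGreatest hj h

/-- If some `j ≤ k` satisfies the condition then so does `k₁`. [cite: Balaban1988Convergent, p.270] -/
theorem covCond_kOne {L M : ℝ} {R : ℕ → ℝ} {k j : ℕ} (hj : j ≤ k) (h : covCond L M R k j) :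
    covCond L M R k (kOne L M R k) := by
  classical
  exact Nat.findGreatest_spec hj h

/-- No index strictly between `k₁` and `k` satisfies the condition. [cite: Balaban1988Convergent, p.270] -/
theorem not_covCond_of_kOne_lt {L M : ℝ} {R : ℕ → ℝ} {k j : ℕ} (h₁ : kOne L M R k < j) (h₂ : j ≤ k) :
    ¬ covCond L M R k j := by
  classical
  exact Nat.findGreatest_is_greatest h₁ h₂

/-- **The condition is downward closed in `j`** when `L ≥ 1`, `M ≥ 0` and `R` is non-decreasing ((2.5): `R_j`
grows with `j`): `j′ ≤ j ≤ k`, `covCond k j ⇒ covCond k j′` — "for k − j large enough, more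
precisely for j ≤ k₁". [cite: Balaban1988Convergent, p.270; (2.5) p.255] -/
theorem covCond_anti {L M : ℝ} (hL : 1 ≤ L) (hM : 0 ≤ M) {R : ℕ → ℝ} (hR : Monotone R)
    {k j j' : ℕ} (hj' : j' ≤ j) (hj : j ≤ k) (h : covCond L M R k j) : covCond L M R k j' := by
  have hL0 : 0 < L := by linarith
  rw [covCond_iff_mul hL0] at h ⊢
  have h1 : M * R j' ≤ M * R j := mul_le_mul_of_nonneg_left (hR hj') hM
  have h2 : L * L ^ (k - j) ≤ L * L ^ (k - j') :=
    mul_le_mul_of_nonneg_left (pow_le_pow_right₀ hL (by omega)) hL0.le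
  exact h1.trans (h.trans h2)

/-- Hence, in the monotone case, the condition holds for EVERY `j ≤ k₁` as soon as it holds for some `j ≤ k`
(equivalently at `k₁` itself) — the form used by the covariance argument of p. 271.
[cite: Balaban1988Convergent, pp.270–271] -/
theorem covCond_of_le_kOne {L M : ℝ} (hL : 1 ≤ L) (hM : 0 ≤ M) {R : ℕ → ℝ} (hR : Monotone R)
    {k j₀ : ℕ} (hj₀ : j₀ ≤ k) (h₀ : covCond L M R k j₀) {j : ℕ} (hj : j ≤ kOne L M R k) :
    covCond L M R k j :=
  covCond_anti hL hM hR hj (kOne_le L M R k) (covCond_kOne hj₀ h₀)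

/-! ## The split `𝐑′_k`, `𝐑″_k` and the absorption into `𝐄_k` -/

section Split

variable {α : Type*} [AddCommMonoid α]

/-- **p. 271: `𝐑′_k := Σ_{j=1}^{k₁} 𝐑^{(j)}`** (the part with `T^{(k+1)}`-Euclidean covariance, included into
`𝐄_k`), for an abstract family `Rj : ℕ → α` of terms. [cite: Balaban1988Convergent, p.271] -/
def RPrime (Rj : ℕ → α) (k₁ : ℕ) : α := ∑ j ∈ Ico 1 (k₁ + 1), Rj j

/-- **p. 271: `𝐑″_k := Σ_{j=k₁+1}^{k} 𝐑^{(j)}`** ("treated separately"). [cite: Balaban1988Convergent, p.271] -/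
def RDoublePrime (Rj : ℕ → α) (k₁ k : ℕ) : α := ∑ j ∈ Ico (k₁ + 1) (k + 1), Rj j

/-- `𝐑′_k` written with the closed range `j = 1, …, k₁`. [cite: Balaban1988Convergent, p.271] -/
theorem RPrime_eq_sum_Icc (Rj : ℕ → α) (k₁ : ℕ) : RPrime Rj k₁ = ∑ j ∈ Icc 1 k₁, Rj j := by
  rw [RPrime]
  congr 1

/-- `𝐑″_k` written with the closed range `j = k₁ + 1, …, k`. [cite: Balaban1988Convergent, p.271] -/
theorem RDoublePrime_eq_sum_Icc (Rj : ℕ → α) (k₁ k : ℕ) :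
    RDoublePrime Rj k₁ k = ∑ j ∈ Icc (k₁ + 1) k, Rj j := by
  rw [RDoublePrime]
  congr 1

/-- **The split is a split**: `𝐑′_k + 𝐑″_k = Σ_{j=1}^{k} 𝐑^{(j)} (= 𝐑_k)` for `k₁ ≤ k`.
[cite: Balaban1988Convergent, pp.270–271; (2.19) p.258] -/
theorem RPrime_add_RDoublePrime (Rj : ℕ → α) {k₁ k : ℕ} (h : k₁ ≤ k) :
    RPrime Rj k₁ + RDoublePrime Rj k₁ k = ∑ j ∈ Ico 1 (k + 1), Rj j := by
  rw [RPrime, RDoublePrime]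
  exact sum_Ico_consecutive Rj (by omega) (by omega)

/-- `k₁ = 0`: `𝐑′_k` is empty and `𝐑″_k` is everything. [cite: Balaban1988Convergent, p.271] -/
theorem RPrime_zero (Rj : ℕ → α) : RPrime Rj 0 = 0 := by
  simp [RPrime]

/-- `k₁ = k`: `𝐑″_k` is empty. [cite: Balaban1988Convergent, p.271] -/
theorem RDoublePrime_self (Rj : ℕ → α) (k : ℕ) : RDoublePrime Rj k k = 0 := by
  simp [RDoublePrime]

/-- **"The sum of the two expressions, 𝐑′_k and 𝐄_k, is denoted also by 𝐄_k"**: the regular part is unchanged,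
`𝐄_k + Σ_{j=1}^{k} 𝐑^{(j)} = (𝐄_k + 𝐑′_k) + 𝐑″_k`. [cite: Balaban1988Convergent, p.271] -/
theorem absorb_RPrime (E : α) (Rj : ℕ → α) {k₁ k : ℕ} (h : k₁ ≤ k) :
    E + ∑ j ∈ Ico 1 (k + 1), Rj j = (E + RPrime Rj k₁) + RDoublePrime Rj k₁ k := by
  rw [add_assoc, RPrime_add_RDoublePrime Rj h]

end Split

/-! ## "The cubes of the partition are contained in L-cubes": nested `L`-adic partitions -/

/-- One coordinate: the `L^a`-adic interval containing `x ∈ ℤ` determines the `L^b`-adic one for `a ≤ b`,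
`⌊⌊x/L^a⌋/L^{b−a}⌋ = ⌊x/L^b⌋` — partitions of `ℤ` into intervals of lengths `L^a ∣ L^b` are nested, so every
cube of side `L^a` of an `L`-adic partition lies in a cube of side `L^b` (applied with the sides
`L^{−(k−j)}MR_j ≤ L`, all powers of `L`). [cite: Balaban1988Convergent, pp.270–271] -/
theorem ladic_nested (L : ℕ) {a b : ℕ} (hab : a ≤ b) (x : ℤ) :
    x / (L : ℤ) ^ a / (L : ℤ) ^ (b - a) = x / (L : ℤ) ^ b := by
  rw [Int.ediv_ediv_of_nonneg (by positivity), ← pow_add, Nat.add_sub_cancel' hab]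

/-- Coordinatewise version for cubes of `ℤ^d`: the side-`L^a` cube label of a site determines its side-`L^b` cube
label (`a ≤ b`). [cite: Balaban1988Convergent, pp.270–271] -/
theorem ladic_nested_cube {d : ℕ} (L : ℕ) {a b : ℕ} (hab : a ≤ b) (x : Fin d → ℤ) :
    (fun μ => x μ / (L : ℤ) ^ a / (L : ℤ) ^ (b - a)) = fun μ => x μ / (L : ℤ) ^ b := by
  funext μ
  exact ladic_nested L hab (x μ)

/-- Consequently two sites in the same side-`L^a` cube are in the same side-`L^b` cube (`a ≤ b`).
[cite: Balaban1988Convergent, pp.270–271] -/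
theorem same_coarse_cube_of_same_fine_cube {d : ℕ} (L : ℕ) {a b : ℕ} (hab : a ≤ b) {x y : Fin d → ℤ}
    (h : (fun μ => x μ / (L : ℤ) ^ a) = fun μ => y μ / (L : ℤ) ^ a) :
    (fun μ => x μ / (L : ℤ) ^ b) = fun μ => y μ / (L : ℤ) ^ b := by
  funext μ
  have hμ : x μ / (L : ℤ) ^ a = y μ / (L : ℤ) ^ a := congrFun h μ
  rw [← ladic_nested L hab (x μ), ← ladic_nested L hab (y μ), hμ]

end Literature.MathematicalPhysics.QuantumFieldTheory.Balaban1983to89.B14.RSplit
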